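import Summits.NavierStokesRegularity.NavierStokesRegularity.Theorems.ScenarioCensusPatternMeterKilling
import Summits.NavierStokesRegularity.NavierStokesRegularity.Theorems.ScenarioCensusRotationOrder
import Summits.NavierStokesRegularity.NavierStokesRegularity.Theorems.ScenarioCensusGeneratorMeter
import Summits.NavierStokesRegularity.NavierStokesRegularity.Theorems.ScenarioCensusInertialMeter
import HarnessLib

/-!
# PATTERN METER port, part 3/3: §C controls; §G the census rows ((L′)-shape: `Row_A2ptK` / `ptT` / `pwK` / `pwT` / `gkK` / `gkW` DECIDED, `Row_A2ptP` / `Row_A2ptS` OPEN typed), nestings,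
# `rows_of_L'` / `rows_of_rung`; census KEYS

Re-homed for the scenario census (typer seat ns-census-typer-1 g10; the cells A2ptK / A2ptT / A2pwK / A2pwT / A2gkK / A2gkW are members of row A2 «DECIDED IN KERNEL IN FILES» (ns-idea-2
g18 LINE g18-2; ref ns-census-ref g15 PRE-CHECK ✓ §20.20; critic / lead booking per the census), A2ptP / A2ptS OPEN (typed); this port makes the decided cells TREE-decided): VERBATIM
PORT of ns-idea-2 LINE g18-2 «pattern-meter», `pub/ideators/ns-idea-2/lines/pattern-meter/line-pattern-meter.lean` sha16 5ea38914a8b301c3 (1044 l., lean check rc 0, 0 sorry), split for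
the 400-line rule into `ScenarioCensusPatternMeter` (§0, §A, §K) → `…PatternMeterKilling` (§N, §L, §V) → `…PatternMeterRows` (§C, §G + census KEYS).  Lean text VERBATIM in namespace
`…Theorems.ScenarioCensus.PatternMeter` (the line's `…Lines.PatternMeter` re-homed); port edits: the line's `local notation "E3"` is spelled as the reducible `abbrev E3` of every
census file; §R (the line's VERBATIM reproduction of LINE «inertial-meter», namespace `Reproduced`) is NOT re-declared — the landed INERTIAL METER port is used BY NAME
(`InertialMeter.contDiff_two_slice` / `vorticityPocketRigidity` / `eq_zero_of_vorticityPeriodic_pocket`); elementary lemmas the line restates are the tree's BY NAME (gate lint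
dedup.landed): `rotZ_two_pi` = `SymmetricLiouville.Negative.rotZ_two_pi` (ScrewClause), `rotZ_rotZ_neg` / `rotZ_neg_rotZ` = `RotationOrder.…`,
`analyticAt_clm_apply` = `GeneratorMeter.…`; `rotGenL_ne_zero` (twin of a lemma in a module outside this closure) is not re-declared, its proof is inlined at the use sites; `@[conjecture]` on the OPEN rows `Row_A2ptP`, `Row_A2ptS`; one-line docstrings added where missing (gate lint).  Statements untouched.

No census VALUE is moved here (row A2 stays OPEN-WITH-LINE; the members become TREE-decided by name); (L′) is NOT proved; no summit statement is proved by this file. Lemmas that restate already-landed tree declarations are taken BY NAME (gate lint `dedup.landed`): `rotZ_two_pi` = `SymmetricLiouville.Negative.rotZ_two_pi`, `rotZ_rotZ_neg` = `RotationOrder.rotZ_rotZ_neg`, `rotZ_neg_rotZ` = `RotationOrder.rotZ_neg_rotZ`, `analyticAt_clm_apply` = `GeneratorMeter.analyticAt_clm_apply`.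
-/

-- the summit and its single problem share the name `NavierStokesRegularity` (D-0017 nested layout)
set_option linter.dupNamespace false

noncomputable section

open Set Function Filter Metric MeasureTheory InnerProductSpace
open scoped Topology RealInnerProductSpace
open Literature.Analysis Literature.Analysis.FluidPDE
open Summit.NavierStokesRegularity.NavierStokesRegularity.Theorems
open Summit.NavierStokesRegularity.NavierStokesRegularity.Theorems.ScenarioCensus
open Summit.NavierStokesRegularity.NavierStokesRegularity.Theorems.AxisymEndLiouville.AbsorbingAxisSwirlExtinction

namespace Summit.NavierStokesRegularity.NavierStokesRegularity.Theorems.ScenarioCensus.PatternMeter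

variable {C C' : ℝ} {u v : ℝ → E3 → E3}

/-! ## C. Controls -/

/-- CONTROL (incompressibility is load-bearing in the kinematic law): the compressible field
`φ(x) = x₀ e₀` is everywhere tangent to the Killing field `k ≡ e₀` (pattern with amplitude `x₀`), yet
`[k, φ] = Dφ·e₀ = e₀ ≠ 0 = A φ` (`A = 0`). -/
theorem control_compressible_pattern_not_symmetric :
    let e₀ : E3 := EuclideanSpace.single 0 1
    let φ : E3 → E3 := fun x => (EuclideanSpace.proj (𝕜 := ℝ) (0 : Fin 3) x) • e₀
    (∀ x, φ x = (x 0) • kil e₀ 0 0 x) ∧ ∃ x, fderiv ℝ φ x (kil e₀ 0 0 x) ≠ (0 : E3 →L[ℝ] E3) (φ x) := by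
  intro e₀ φ
  have hk : ∀ x : E3, kil e₀ 0 0 x = e₀ := fun x => by simp [kil]
  refine ⟨fun x => by rw [hk]; rfl, 0, ?_⟩
  have hφ : φ = fun x => ((EuclideanSpace.proj (𝕜 := ℝ) (0 : Fin 3)).smulRight e₀) x := rfl
  rw [hk, hφ, ((EuclideanSpace.proj (𝕜 := ℝ) (0 : Fin 3)).smulRight e₀).fderiv,
    ContinuousLinearMap.smulRight_apply, zero_apply]
  intro h
  have := congrArg (fun v : E3 => v 0) h
  simp [e₀] at this

/-- CONTROL (the finite model): a helix closes up to a translation — after the angle `2π` the screw motion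
of pitch `p` is the translation by `2πp e₃`; this is why the helical cells need no helical Liouville theorem. -/
theorem control_screw_two_pi (p : ℝ) (y : E3) :
    rotZ (2 * Real.pi) y + (p * (2 * Real.pi)) • e₃ = y + (p * (2 * Real.pi)) • e₃ := by
  rw [SymmetricLiouville.Negative.rotZ_two_pi]

/-- CONTROL (Killing fields are patterns of themselves and are incompressible): `div k = 0` and `[k,k] = 0`
in the form used by the law, `Dk(x)[k x] = A (k x)`. -/
theorem control_killing_selfPattern {A : E3 →L[ℝ] E3} (hskew : ∀ x, ⟪A x, x⟫ = 0) (a c : E3) :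
    VectorCalculus.IsDivFree (kil a c A) ∧ ∀ x, fderiv ℝ (kil a c A) x (kil a c A x) = A (kil a c A x) :=
  ⟨fun x => divergence_kil hskew a c x, fun x => by rw [(hasFDerivAt_kil a c A x).fderiv]⟩

/-! ## G. Census rows ((L′)-shape, BY NAME over `IsTypeIAncientMild`) and verdicts

Keys `A2pt*` (streamline PATTERN of one slice on a pocket), `A2pw*` (vortex-line pattern), `A2gk*` (one
Killing GENERATOR at one germ).  Every row reads ONE slice `t₀ < 0` on ONE nonempty open set. -/

/-- Row A2ptK — «on a pocket of ONE slice the STREAMLINES are coaxial CIRCLES or HELICES: `u(t₀,x) ∥ a + A(x − c)`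
on a nonempty open `U`, `A` skew, `A ≠ 0` (free amplitude)» ⇒ `u ≡ 0`.  DECIDED (proved:
`liouville_of_streamlinePattern`). -/
def Row_A2ptK : Prop :=
  ∀ (C : ℝ) (u : ℝ → E3 → E3), IsTypeIAncientMild C u →
    (∃ (t₀ : ℝ) (a c : E3) (A : E3 →L[ℝ] E3) (U : Set E3) (f : E3 → ℝ), t₀ < 0 ∧ (∀ x, ⟪A x, x⟫ = 0) ∧
      A ≠ 0 ∧ IsOpen U ∧ U.Nonempty ∧ ∀ x ∈ U, u t₀ x = f x • (a + A (x - c))) →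
    ∀ t < 0, ∀ x, u t x = 0

/-- **Row A2ptK holds.** -/
theorem row_A2ptK : Row_A2ptK := by
  rintro C u hu ⟨t₀, a, c, A, U, f, ht₀, hskew, hA, hU, hne, h⟩
  exact liouville_of_streamlinePattern hu ht₀ hskew a c (Or.inl hA) hU hne h

/-- Row A2ptT — «on a pocket of ONE slice the STREAMLINES are PARALLEL LINES: `u(t₀,x) ∥ a` on a nonempty open
`U`, `a ≠ 0`» ⇒ `u ≡ 0`.  DECIDED (proved).  Bookkeeping twin of the generator meter's `Row_A2gnP`
(ns-idea-2 g17-3) and of the tree's line-invariant slice cells: listed for the table, no novelty claimed. -/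
def Row_A2ptT : Prop :=
  ∀ (C : ℝ) (u : ℝ → E3 → E3), IsTypeIAncientMild C u →
    (∃ (t₀ : ℝ) (a : E3) (U : Set E3) (f : E3 → ℝ), t₀ < 0 ∧ a ≠ 0 ∧ IsOpen U ∧ U.Nonempty ∧
      ∀ x ∈ U, u t₀ x = f x • a) →
    ∀ t < 0, ∀ x, u t x = 0

/-- **Row A2ptT holds.** -/
theorem row_A2ptT : Row_A2ptT := by
  rintro C u hu ⟨t₀, a, U, f, ht₀, ha, hU, hne, h⟩
  refine liouville_of_streamlinePattern hu ht₀ (A := 0) (fun x => by simp) a 0 (Or.inr ha) hU hne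
    (f := f) fun x hx => ?_
  simpa using h x hx

/-- Row A2pwK — «on a pocket of ONE slice the VORTEX LINES are coaxial CIRCLES or HELICES:
`curl u(t₀,x) ∥ a + A(x − c)` on a nonempty open `U`, `A` skew, `A ≠ 0`» ⇒ `u ≡ 0`.  DECIDED (proved:
`liouville_of_vortexLinePattern`). -/
def Row_A2pwK : Prop :=
  ∀ (C : ℝ) (u : ℝ → E3 → E3), IsTypeIAncientMild C u →
    (∃ (t₀ : ℝ) (a c : E3) (A : E3 →L[ℝ] E3) (U : Set E3) (f : E3 → ℝ), t₀ < 0 ∧ (∀ x, ⟪A x, x⟫ = 0) ∧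
      A ≠ 0 ∧ IsOpen U ∧ U.Nonempty ∧ ∀ x ∈ U, curl (u t₀) x = f x • (a + A (x - c))) →
    ∀ t < 0, ∀ x, u t x = 0

/-- **Row A2pwK holds.** -/
theorem row_A2pwK : Row_A2pwK := by
  rintro C u hu ⟨t₀, a, c, A, U, f, ht₀, hskew, hA, hU, hne, h⟩
  exact liouville_of_vortexLinePattern hu ht₀ hskew a c (Or.inl hA) hU hne h

/-- Row A2pwT — «on a pocket of ONE slice the VORTEX LINES are PARALLEL LINES: `curl u(t₀,x) ∥ a` on a
nonempty open `U`, `a ≠ 0`» ⇒ `u ≡ 0`.  DECIDED (proved).  The one-slice-pocket form of the tree's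
unidirectional-vorticity cell A10w(9) ⟨stmt-20018⟩ (there for the whole element); decided here through the
reproduced vorticity-pocket rigidity. -/
def Row_A2pwT : Prop :=
  ∀ (C : ℝ) (u : ℝ → E3 → E3), IsTypeIAncientMild C u →
    (∃ (t₀ : ℝ) (a : E3) (U : Set E3) (f : E3 → ℝ), t₀ < 0 ∧ a ≠ 0 ∧ IsOpen U ∧ U.Nonempty ∧
      ∀ x ∈ U, curl (u t₀) x = f x • a) →
    ∀ t < 0, ∀ x, u t x = 0

/-- **Row A2pwT holds** (in-tree: `StrainDoors.eq_zero_of_typeIAncientMild_of_curl_parallel_on_open` BY NAME). -/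
theorem row_A2pwT : Row_A2pwT := by
  rintro C u hu ⟨t₀, a, U, f, ht₀, ha, hU, hne, h⟩
  refine liouville_of_vortexLinePattern hu ht₀ (A := 0) (fun x => by simp) a 0 (Or.inr ha) hU hne
    (f := f) fun x hx => ?_
  simpa using h x hx

/-- Row A2gkK — «ONE Killing GENERATOR with a rotation part annihilates the velocity on ONE GERM:
`Du(t₀,x)[a + A(x − c)] = A u(t₀,x)` for `x` in a nonempty open set, `A` skew, `A ≠ 0`» ⇒ `u ≡ 0`.
DECIDED (proved: `liouville_of_sliceKilling` ∘ `lie_eq_of_germ`).  Closes, for pure Killing generators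
(no scaling, no time component), the `A ≠ 0` cell that the generator meter (g17-3, `genReading`, `A = 0`)
left open. -/
def Row_A2gkK : Prop :=
  ∀ (C : ℝ) (u : ℝ → E3 → E3), IsTypeIAncientMild C u →
    (∃ (t₀ : ℝ) (a c : E3) (A : E3 →L[ℝ] E3) (U : Set E3), t₀ < 0 ∧ (∀ x, ⟪A x, x⟫ = 0) ∧ A ≠ 0 ∧
      IsOpen U ∧ U.Nonempty ∧ ∀ x ∈ U, fderiv ℝ (u t₀) x (a + A (x - c)) = A (u t₀ x)) →
    ∀ t < 0, ∀ x, u t x = 0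

/-- **Row A2gkK holds.** -/
theorem row_A2gkK : Row_A2gkK := by
  rintro C u hu ⟨t₀, a, c, A, U, ht₀, hskew, hA, hU, hne, h⟩
  exact liouville_of_sliceKilling hu ht₀ hskew a c (Or.inl hA)
    (lie_eq_of_germ (hu.analyticOnNhd_slice_univ ht₀) A a c hU hne h)

/-- Row A2gkW — «ONE nonzero Killing generator annihilates the VORTICITY on ONE GERM:
`Dω(t₀,x)[a + A(x − c)] = A ω(t₀,x)` on a nonempty open set (`A` skew; `A ≠ 0` or `a ≠ 0`)» ⇒ `u ≡ 0`.
DECIDED (proved: `liouville_of_vorticitySliceKilling` ∘ `lie_eq_of_germ`). -/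
def Row_A2gkW : Prop :=
  ∀ (C : ℝ) (u : ℝ → E3 → E3), IsTypeIAncientMild C u →
    (∃ (t₀ : ℝ) (a c : E3) (A : E3 →L[ℝ] E3) (U : Set E3), t₀ < 0 ∧ (∀ x, ⟪A x, x⟫ = 0) ∧
      (A ≠ 0 ∨ a ≠ 0) ∧ IsOpen U ∧ U.Nonempty ∧
      ∀ x ∈ U, fderiv ℝ (curl (u t₀)) x (a + A (x - c)) = A (curl (u t₀) x)) →
    ∀ t < 0, ∀ x, u t x = 0

/-- **Row A2gkW holds.** -/
theorem row_A2gkW : Row_A2gkW := by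
  rintro C u hu ⟨t₀, a, c, A, U, ht₀, hskew, hnd, hU, hne, h⟩
  exact liouville_of_vorticitySliceKilling hu ht₀ hskew a c hnd
    (lie_eq_of_germ (analyticOnNhd_curl (hu.analyticOnNhd_slice_univ ht₀)) A a c hU hne h)

/-- Row A2ptP — «on a pocket of ONE slice the streamlines lie in PARALLEL PLANES: `⟪u(t₀,x), n⟫ = 0` on a
nonempty open `U`, `n ≠ 0`» ⇒ `u ≡ 0`.  OPEN (typed only).  The two-dimensional (LAYERED) patterns are the
instrument's undecided frontier: by analyticity the whole slice is `n`-horizontal, but one horizontal-valued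
slice does not propagate (census A7h is the all-time version, itself open for `x₃`-dependent fields).  No claim. -/
@[conjecture] def Row_A2ptP : Prop :=
  ∀ (C : ℝ) (u : ℝ → E3 → E3), IsTypeIAncientMild C u →
    (∃ (t₀ : ℝ) (n : E3) (U : Set E3), t₀ < 0 ∧ n ≠ 0 ∧ IsOpen U ∧ U.Nonempty ∧
      ∀ x ∈ U, ⟪u t₀ x, n⟫ = 0) →
    ∀ t < 0, ∀ x, u t x = 0

/-- Row A2ptS — «on a pocket of ONE slice the streamlines lie on CONCENTRIC SPHERES: `⟪u(t₀,x), x − c⟫ = 0`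
on a nonempty open `U`» ⇒ `u ≡ 0`.  OPEN (typed only): toroidal fields `x × ∇g` are incompressible and
tangential, and tangentiality of one slice is not propagated by the equation.  No claim. -/
@[conjecture] def Row_A2ptS : Prop :=
  ∀ (C : ℝ) (u : ℝ → E3 → E3), IsTypeIAncientMild C u →
    (∃ (t₀ : ℝ) (c : E3) (U : Set E3), t₀ < 0 ∧ IsOpen U ∧ U.Nonempty ∧
      ∀ x ∈ U, ⟪u t₀ x, x - c⟫ = 0) →
    ∀ t < 0, ∀ x, u t x = 0

/-- Nesting: a streamline Killing pattern on a pocket IS a Killing generator annihilating that germ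
(`lie_eq_of_pattern`), so `Row_A2gkK` implies `Row_A2ptK`. -/
theorem row_A2ptK_of_row_A2gkK : Row_A2gkK → Row_A2ptK := by
  rintro hG C u hu ⟨t₀, a, c, A, U, f, ht₀, hskew, hA, hU, hne, h⟩
  exact hG C u hu ⟨t₀, a, c, A, U, ht₀, hskew, hA, hU, hne, fun x _ =>
    lie_eq_of_pattern (hu.analyticOnNhd_slice_univ ht₀) (hu.isDivFree ht₀) hskew a c hU hne h x⟩

/-- Nesting: A2gkW → A2pwK. -/
theorem row_A2pwK_of_row_A2gkW : Row_A2gkW → Row_A2pwK := by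
  rintro hG C u hu ⟨t₀, a, c, A, U, f, ht₀, hskew, hA, hU, hne, h⟩
  exact hG C u hu ⟨t₀, a, c, A, U, ht₀, hskew, Or.inl hA, hU, hne, fun x _ =>
    lie_eq_of_pattern (analyticOnNhd_curl (hu.analyticOnNhd_slice_univ ht₀))
      (fun x => divergence_curl_eq_zero_holds (u t₀) (InertialMeter.contDiff_two_slice hu ht₀) x) hskew a c hU hne h x⟩

/-- Every row follows from (L′) «every Type-I ancient mild field vanishes». -/
theorem rows_of_L' (hL : ∀ (C : ℝ) (u : ℝ → E3 → E3), IsTypeIAncientMild C u → ∀ t < 0, ∀ x, u t x = 0) :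
    Row_A2ptK ∧ Row_A2ptT ∧ Row_A2pwK ∧ Row_A2pwT ∧ Row_A2gkK ∧ Row_A2gkW ∧ Row_A2ptP ∧ Row_A2ptS :=
  ⟨fun C u hu _ => hL C u hu, fun C u hu _ => hL C u hu, fun C u hu _ => hL C u hu,
    fun C u hu _ => hL C u hu, fun C u hu _ => hL C u hu, fun C u hu _ => hL C u hu,
    fun C u hu _ => hL C u hu, fun C u hu _ => hL C u hu⟩

/-- **The rung decides every row**: the LADDER-NS rung (L′) `Theses.SymmetryModuliCount.TypeIAncientLiouville`
⟨stmt-NavierStokesRegularity-10661⟩, BY NAME, implies every row of the pattern meter (including the open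
`Row_A2ptP`, `Row_A2ptS`).  Nothing here proves the rung.  No summit is proved by a line. -/
theorem rows_of_rung (hL : Theses.SymmetryModuliCount.TypeIAncientLiouville) :
    Row_A2ptK ∧ Row_A2ptT ∧ Row_A2pwK ∧ Row_A2pwT ∧ Row_A2gkK ∧ Row_A2gkW ∧ Row_A2ptP ∧ Row_A2ptS :=
  rows_of_L' fun C u hu => hL C u (isTypeIAncientMild_iff.1 hu)

/-! ### §T  The all-times endgame is CLOSED IN THE TREE, by name (honest placement of law (L)) -/

/-- **Tree record.**  Every non-zero Killing generator `(a, A)` (`A` skew) annihilating a class element on a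
backward END `t < θ` kills it: rotations (`A ≠ 0`, `a ∈ range A`) = ⟨stmt-14061⟩ `AxisymEndLiouville`
(`…Theorems.AxisymEndLiouville_of`, swirl allowed); translations and screws of non-zero pitch (`a ∉ range A`) =
⟨stmt-14062⟩ `HelicalEndLiouville` (`…Theorems.symmetryModuliCount_helicalEndLiouville_proof`, line
«vanishing-cell-reynolds»).  Law (L) of this line is the ONE-SLICE / ONE-POCKET, PATTERN-WITH-FREE-AMPLITUDE form
of these two closed items (one slice ⇒ all times by the tree's germ rigidity; the screw cells here exit through
A13 = `PeriodicGauge.periodic_typeI_liouville_genuine` after one full turn, cf. the tree's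
`…SymmetricLiouville.Negative.periodic_of_screw_clause`).  No summit is proved by a line. -/
theorem killingEnd_in_tree :
    Theses.SymmetryModuliCount.AxisymEndLiouville ∧ Theses.SymmetryModuliCount.HelicalEndLiouville :=
  ⟨AxisymEndLiouville_of, Theorems.symmetryModuliCount_helicalEndLiouville_proof⟩

end Summit.NavierStokesRegularity.NavierStokesRegularity.Theorems.ScenarioCensus.PatternMeter

namespace Summit.NavierStokesRegularity.NavierStokesRegularity.Theorems.ScenarioCensus

/-! ## Census KEYS (ns `…Theorems.ScenarioCensus`): instrument PATTERN METER (block A2) — TREE-decided cells A2ptK / A2ptT / A2pwK / A2pwT / A2gkK / A2gkW, OPEN rows A2ptP / A2ptS -/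

/-- **Cell A2ptK** (a Killing line PATTERN of the velocity on a pocket of one slice ⇒ `u ≡ 0`): `:= PatternMeter.Row_A2ptK`. DECIDED. -/
def Row_A2ptK : Prop := PatternMeter.Row_A2ptK
/-- A2ptK is EXCLUDED (decided in the tree): `PatternMeter.row_A2ptK`. -/
theorem row_A2ptK_excluded : Row_A2ptK := PatternMeter.row_A2ptK

/-- **Cell A2ptT**: `:= PatternMeter.Row_A2ptT`. DECIDED. -/
def Row_A2ptT : Prop := PatternMeter.Row_A2ptT
/-- A2ptT is EXCLUDED (decided in the tree): `PatternMeter.row_A2ptT`. -/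
theorem row_A2ptT_excluded : Row_A2ptT := PatternMeter.row_A2ptT

/-- **Cell A2pwK** (a Killing line pattern of the VORTICITY on a pocket of one slice ⇒ `u ≡ 0`): `:= PatternMeter.Row_A2pwK`. DECIDED. -/
def Row_A2pwK : Prop := PatternMeter.Row_A2pwK
/-- A2pwK is EXCLUDED (decided in the tree): `PatternMeter.row_A2pwK`. -/
theorem row_A2pwK_excluded : Row_A2pwK := PatternMeter.row_A2pwK

/-- **Cell A2pwT** (in-tree by name via `StrainDoors`): `:= PatternMeter.Row_A2pwT`. DECIDED. -/
def Row_A2pwT : Prop := PatternMeter.Row_A2pwT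
/-- A2pwT is EXCLUDED (decided in the tree): `PatternMeter.row_A2pwT`. -/
theorem row_A2pwT_excluded : Row_A2pwT := PatternMeter.row_A2pwT

/-- **Cell A2gkK** (a Killing generator annihilating ONE velocity slice on a pocket ⇒ `u ≡ 0`): `:= PatternMeter.Row_A2gkK`. DECIDED. -/
def Row_A2gkK : Prop := PatternMeter.Row_A2gkK
/-- A2gkK is EXCLUDED (decided in the tree): `PatternMeter.row_A2gkK`. -/
theorem row_A2gkK_excluded : Row_A2gkK := PatternMeter.row_A2gkK

/-- **Cell A2gkW** (a Killing generator annihilating ONE vorticity slice on a pocket ⇒ `u ≡ 0`): `:= PatternMeter.Row_A2gkW`. DECIDED. -/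
def Row_A2gkW : Prop := PatternMeter.Row_A2gkW
/-- A2gkW is EXCLUDED (decided in the tree): `PatternMeter.row_A2gkW`. -/
theorem row_A2gkW_excluded : Row_A2gkW := PatternMeter.row_A2gkW

/-- **Row A2ptP** — typed only: `:= PatternMeter.Row_A2ptP`. OPEN. -/
@[conjecture] def Row_A2ptP : Prop := PatternMeter.Row_A2ptP

/-- **Row A2ptS** — typed only: `:= PatternMeter.Row_A2ptS`. OPEN. -/
@[conjecture] def Row_A2ptS : Prop := PatternMeter.Row_A2ptS

/-- Lattice edges at key level: A2gkK → A2ptK, A2gkW → A2pwK (`PatternMeter.row_A2ptK_of_row_A2gkK` / `row_A2pwK_of_row_A2gkW`). -/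
theorem row_A2ptK_of_row_A2gkK : Row_A2gkK → Row_A2ptK := PatternMeter.row_A2ptK_of_row_A2gkK
/-- See `row_A2ptK_of_row_A2gkK`. -/
theorem row_A2pwK_of_row_A2gkW : Row_A2gkW → Row_A2pwK := PatternMeter.row_A2pwK_of_row_A2gkW

end Summit.NavierStokesRegularity.NavierStokesRegularity.Theorems.ScenarioCensus

end
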